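import Literature.NumberTheory.LFunctions.SuzukiSingleOperatorKernelProofs
import Literature.Analysis.SpecialFunctions.DigammaStirlingSeries

/-!
# SuzukiWindowsDoorExplicitSymbol — explicit bounds for Suzuki's single-operator symbol `Θ_θ` and kernel `K_θ` on a line `Re s = σ` (column DBR; RH-FREE)

RH-FREE throughout; nothing here bears on the truth of RH.  This is the analytic half of an EXPLICIT version of
[Su20] Thm 1.2 (K-v) (M. Suzuki, ASPM 84 (2020) = arXiv:1907.07302: for `θ > 1` there is an INEXPLICIT `τ > 0` with
`±1 ∉ σ_p(𝖪_θ[t])` for `0 ≤ t < τ`; tree: `Suzuki2020_thm12_Kv`).  The sequel file `SuzukiWindowsDoorExplicitWindow`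
turns the line bound below into the onset envelope `|K_θ(x)| ≤ A_θ x^{θ−1}` (line `σ = (θ−1)/x`) and into explicit
unit-eigenvalue-free windows via the weighted Hilbert–Schmidt test of `SuzukiHSWindow`.  Everything is spectral-side
(absolute convergence on `Re s > 1`, Stirling for `ψ`); no zeros of `ζ` enter.

* §1 the prime-power tail `Z(σ) = Σ ‖Λ(n) n^{−σ}‖ ≤ (π²/6)·2^{3−σ}` for `σ ≥ 3`, and `|Σ Λ(n)n^{−s}| ≤ Z(Re s)`;
* §2 an explicit Stirling-grade lower bound for `Re ξ'/ξ(s)`, `Re s > 1`: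
  `½ log(‖s‖/2π) + Re 1/(2s) + Re 1/(s−1) − 1/(6‖s‖²) − 1/(π σ ‖s‖²) − Z(σ) ≤ Re ξ'/ξ(s)` (the tree's explicit formula
  `logDeriv_riemannXi_eq_of_one_lt_re` + the order-1 Stirling remainder `norm_digamma_sub_stirlingSeries_le`, `B₂ = 1/6`);
* §3 the symbol bound on the line `Im z = b`, `σ = ½ + b ≥ 3`, `θ ≥ 2`:
  `‖Θ_θ(u + ib)‖ ≤ (2π)^θ e^{2θ ε(σ)} σ^{−θ} (1 + θu²/(2σ²))⁻¹`, `ε(σ) = 1/(6σ²) + 1/(πσ³) + (π²/6) 2^{3−σ}`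
  (`‖Θ_θ‖ = exp(−2θ Re ξ'/ξ)`, `‖s‖ ≥ σ`, Bernoulli `(1 + u²/σ²)^{θ/2} ≥ 1 + θu²/(2σ²)`), and its `u`-integral
  `∫ ‖Θ_θ(u+ib)‖ du ≤ (2π)^θ e^{2θε(σ)} σ^{−θ} · πσ√(2/θ)` (`∫ du/(1+cu²) = π/√c`);
* §4 the LINE BOUND `|K_θ(x)| ≤ (2π)^{θ−1} π√(2/θ) e^{2θε(σ)} σ^{1−θ} e^{bx}` for all real `x`
  (`|K_θ(x)| ≤ (1/2π) e^{bx} ∫ ‖Θ_θ(u+ib)‖ du`, tree: `norm_invFourierLine_le`, `invFourierLine_limTheta_eq`).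

References: [Su20] M. Suzuki, ASPM 84 (2020) 399–411 = arXiv:1907.07302, §3 (Stirling for `ψ` and `ζ'/ζ` on
`Re s > 1` behind Thm 1.2 (K-ii)); DLMF 5.11.2 (Stirling series for `ψ`).
-/

noncomputable section

-- D-0017: `Summit.<S>.<S>.…` is the designed namespace of a single-problem summit.
set_option linter.dupNamespace false

open MeasureTheory Set Filter Topology Complex

namespace Summit.RiemannHypothesis.RiemannHypothesis.Theorems.SuzukiWindowsDoorExplicitSymbol

open Literature.NumberTheory.LFunctions
open LSeries
open scoped LSeries.notation ArithmeticFunction.vonMangoldt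

/-! ## §1 The prime-power tail `Z(σ) = Σ Λ(n) n^{-σ}` for `σ ≥ 3` -/

/-- Termwise: `‖Λ(n) n^{-σ}‖ ≤ 2^{3−σ}/n²` for `σ ≥ 3` (all `n`; `Λ(n) ≤ log n ≤ n`, `n^{3−σ} ≤ 2^{3−σ}` for `n ≥ 2`). -/
theorem norm_term_vonMangoldt_le {σ : ℝ} (hσ : 3 ≤ σ) (n : ℕ) :
    ‖term ↗Λ (σ : ℂ) n‖ ≤ (2 : ℝ) ^ (3 - σ) * (1 / (n : ℝ) ^ 2) := by
  rw [norm_term_eq]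
  split_ifs with hn
  · positivity
  rcases Nat.lt_or_ge n 2 with hn2 | hn2
  · have h1 : n = 1 := by omega
    subst h1
    have h0 : (0 : ℝ) ≤ (2 : ℝ) ^ (3 - σ) := by positivity
    simpa using h0
  have hnpos : (0 : ℝ) < n := by exact_mod_cast (show 0 < n by omega)
  have hn2' : (2 : ℝ) ≤ n := by exact_mod_cast hn2
  have hΛ : ‖((Λ n : ℝ) : ℂ)‖ ≤ (n : ℝ) := by
    rw [Complex.norm_real, Real.norm_eq_abs, abs_of_nonneg ArithmeticFunction.vonMangoldt_nonneg]
    exact ArithmeticFunction.vonMangoldt_le_log.trans ((Real.log_le_sub_one_of_pos hnpos).trans (by linarith))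
  have hre : ((σ : ℂ)).re = σ := Complex.ofReal_re σ
  rw [hre]
  -- `n / n^σ = n^{3-σ} / n^2 ≤ 2^{3-σ} / n^2`
  have hpow : (n : ℝ) ^ σ = (n : ℝ) ^ 2 * (n : ℝ) ^ (σ - 3) * n := by
    rw [← Real.rpow_natCast, ← Real.rpow_add hnpos, ← Real.rpow_add_one hnpos.ne']
    congr 1; push_cast; ring
  have hle : (n : ℝ) ^ (3 - σ) ≤ (2 : ℝ) ^ (3 - σ) :=
    Real.rpow_le_rpow_of_nonpos (by norm_num) hn2' (by linarith)
  have hpos2 : 0 < (n : ℝ) ^ (σ - 3) := Real.rpow_pos_of_pos hnpos _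
  calc ‖((Λ n : ℝ) : ℂ)‖ / (n : ℝ) ^ σ ≤ (n : ℝ) / (n : ℝ) ^ σ :=
        div_le_div_of_nonneg_right hΛ (by positivity)
    _ = (n : ℝ) ^ (3 - σ) * (1 / (n : ℝ) ^ 2) := by
        rw [hpow, show (3 : ℝ) - σ = -(σ - 3) by ring, Real.rpow_neg hnpos.le]
        field_simp
    _ ≤ (2 : ℝ) ^ (3 - σ) * (1 / (n : ℝ) ^ 2) := by gcongr

/-- Summability of `Σ ‖Λ(n) n^{-σ}‖` for `σ > 1`. -/
theorem summable_norm_term_vonMangoldt {σ : ℝ} (hσ : 1 < σ) :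
    Summable fun n : ℕ => ‖term ↗Λ (σ : ℂ) n‖ := by
  have h := ArithmeticFunction.LSeriesSummable_vonMangoldt (s := (σ : ℂ)) (by simpa using hσ)
  exact summable_norm_iff.mpr h

/-- **Prime-power tail**: `Z(σ) = Σ_n ‖Λ(n) n^{-σ}‖ ≤ (π²/6) · 2^{3−σ}` for `σ ≥ 3`. -/
theorem tsum_norm_term_vonMangoldt_le {σ : ℝ} (hσ : 3 ≤ σ) :
    ∑' n : ℕ, ‖term ↗Λ (σ : ℂ) n‖ ≤ Real.pi ^ 2 / 6 * (2 : ℝ) ^ (3 - σ) := by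
  have hz := hasSum_zeta_two
  have hmaj : HasSum (fun n : ℕ => (2 : ℝ) ^ (3 - σ) * (1 / (n : ℝ) ^ 2)) ((2 : ℝ) ^ (3 - σ) * (Real.pi ^ 2 / 6)) :=
    hz.mul_left _
  calc ∑' n : ℕ, ‖term ↗Λ (σ : ℂ) n‖ ≤ ∑' n : ℕ, (2 : ℝ) ^ (3 - σ) * (1 / (n : ℝ) ^ 2) :=
        (summable_norm_term_vonMangoldt (by linarith)).tsum_le_tsum (norm_term_vonMangoldt_le hσ) hmaj.summable
    _ = Real.pi ^ 2 / 6 * (2 : ℝ) ^ (3 - σ) := by rw [hmaj.tsum_eq]; ring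

/-- `|Σ Λ(n) n^{-s}| ≤ Z(Re s)` (termwise). -/
theorem norm_LSeries_vonMangoldt_le_tsum {s : ℂ} (hs : 1 < s.re) :
    ‖L ↗Λ s‖ ≤ ∑' n : ℕ, ‖term ↗Λ (s.re : ℂ) n‖ := by
  have hsum0 := summable_norm_term_vonMangoldt hs
  have hle : ∀ n, ‖term ↗Λ s n‖ ≤ ‖term ↗Λ (s.re : ℂ) n‖ := fun n ↦
    norm_term_le_of_re_le_re _ (by simp) n
  have hsum : Summable fun n ↦ ‖term ↗Λ s n‖ :=
    Summable.of_nonneg_of_le (fun _ ↦ norm_nonneg _) hle hsum0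
  calc ‖L ↗Λ s‖ = ‖∑' n, term ↗Λ s n‖ := rfl
    _ ≤ ∑' n, ‖term ↗Λ s n‖ := norm_tsum_le_tsum_norm hsum
    _ ≤ ∑' n, ‖term ↗Λ (s.re : ℂ) n‖ := hsum.tsum_le_tsum hle hsum0


/-! ## §2 An explicit Stirling-grade lower bound for `Re ξ'/ξ` on `Re s > 1` -/

/-- Order-1 Stirling for `ψ` at `w = s/2`, `Re s > 0`:
`‖ψ(s/2) − (log(s/2) − 1/s − 1/(3s²))‖ ≤ 2/(π · Re s · ‖s‖²)`
(the tree's `norm_digamma_sub_stirlingSeries_le` with `ν = 1`, `B₂ = 1/6`). -/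
theorem norm_digamma_half_sub_le {s : ℂ} (hs : 0 < s.re) :
    ‖Complex.digamma (s / 2) - (Complex.log (s / 2) - 1 / s - 1 / (3 * s ^ 2))‖ ≤
      2 / (Real.pi * s.re * ‖s‖ ^ 2) := by
  have hw : 0 < (s / 2).re := by simpa using hs
  have h := Literature.Analysis.SpecialFunctions.Complex.norm_digamma_sub_stirlingSeries_le hw (ν := 1) one_ne_zero
  have hs0 : s ≠ 0 := fun h0 => by rw [h0] at hs; simp at hs
  have hsum : ∑ k ∈ Finset.Icc 1 1, (bernoulli (2 * k) : ℂ) / (2 * k) / (s / 2) ^ (2 * k) = 1 / (3 * s ^ 2) := by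
    rw [show Finset.Icc 1 1 = {1} by rfl, Finset.sum_singleton]
    norm_num [bernoulli_two]
    field_simp
    ring
  have hmain : Complex.log (s / 2) - 1 / (2 * (s / 2)) -
      ∑ k ∈ Finset.Icc 1 1, (bernoulli (2 * k) : ℂ) / (2 * k) / (s / 2) ^ (2 * k) =
      Complex.log (s / 2) - 1 / s - 1 / (3 * s ^ 2) := by
    rw [hsum]; congr 2; ring
  rw [hmain] at h
  refine h.trans (le_of_eq ?_)
  have hn : ‖s / 2‖ = ‖s‖ / 2 := by rw [norm_div, Complex.norm_two]
  rw [hn, Complex.div_re, show (2 : ℂ).re = 2 by rfl, show (2 : ℂ).im = 0 by rfl]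
  simp only [Nat.factorial, Nat.succ_eq_add_one, Nat.reduceAdd, Nat.reduceMul, Nat.cast_ofNat, mul_zero]
  rw [Complex.normSq_apply, show (2 : ℂ).re = 2 by rfl, show (2 : ℂ).im = 0 by rfl]
  field_simp
  ring

/-- **Explicit lower bound for `Re ξ'/ξ(s)`, `Re s > 1`** (RH-free; Stirling of order 1 for `ψ(s/2)`, termwise bound
for the von Mangoldt series):
`½ log(‖s‖/(2π)) + Re 1/(2s) + Re 1/(s−1) − 1/(6‖s‖²) − 1/(π σ ‖s‖²) − Z(σ) ≤ Re ξ'/ξ(s)`, `σ = Re s`,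
`Z(σ) = Σ ‖Λ(n) n^{-σ}‖`. -/
theorem re_logDeriv_riemannXi_ge_explicit {s : ℂ} (hs : 1 < s.re) :
    Real.log (‖s‖ / (2 * Real.pi)) / 2 + (1 / (2 * s)).re + (1 / (s - 1)).re
      - 1 / (6 * ‖s‖ ^ 2) - 1 / (Real.pi * s.re * ‖s‖ ^ 2) - ∑' n : ℕ, ‖term ↗Λ (s.re : ℂ) n‖
      ≤ (logDeriv riemannXi s).re := by
  have hs0 : 0 < s.re := by linarith
  have hsne : s ≠ 0 := fun h0 => by rw [h0] at hs; norm_num at hs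
  have hnorm : 0 < ‖s‖ := norm_pos_iff.mpr hsne
  rw [logDeriv_riemannXi_eq_of_one_lt_re hs]
  set E : ℂ := Complex.digamma (s / 2) - (Complex.log (s / 2) - 1 / s - 1 / (3 * s ^ 2)) with hE
  have hEn : ‖E‖ ≤ 2 / (Real.pi * s.re * ‖s‖ ^ 2) := norm_digamma_half_sub_le hs0
  have hEre : -(2 / (Real.pi * s.re * ‖s‖ ^ 2)) ≤ E.re := by
    have := Complex.abs_re_le_norm E
    have := neg_le_of_abs_le this
    linarith
  have hψ : (Complex.digamma (s / 2)).re =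
      (Complex.log (s / 2)).re - (1 / s).re - (1 / (3 * s ^ 2)).re + E.re := by
    have : Complex.digamma (s / 2) = Complex.log (s / 2) - 1 / s - 1 / (3 * s ^ 2) + E := by
      rw [hE]; ring
    rw [this]; simp only [Complex.add_re, Complex.sub_re]
  have hlog : (Complex.log (s / 2)).re = Real.log ‖s‖ - Real.log 2 := by
    rw [Complex.log_re, norm_div, Complex.norm_two, Real.log_div hnorm.ne' (by norm_num)]
  have hlog2 : Real.log (‖s‖ / (2 * Real.pi)) = Real.log ‖s‖ - Real.log 2 - Real.log Real.pi := by
    rw [Real.log_div hnorm.ne' (by positivity), Real.log_mul (by norm_num) Real.pi_pos.ne']; ring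
  have h3 : (1 / (3 * s ^ 2)).re ≤ 1 / (3 * ‖s‖ ^ 2) := by
    refine (Complex.re_le_norm _).trans (le_of_eq ?_)
    rw [norm_div, norm_one, norm_mul, Complex.norm_pow]
    norm_num
  have h4 : ((1 / 2 : ℂ) * Complex.digamma (s / 2)).re = (Complex.digamma (s / 2)).re / 2 := by
    have : ((1 / 2 : ℂ) * Complex.digamma (s / 2)).re = 1 / 2 * (Complex.digamma (s / 2)).re := by
      rw [show (1 / 2 : ℂ) = ((1 / 2 : ℝ) : ℂ) by push_cast; ring, Complex.re_ofReal_mul]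
    rw [this]; ring
  have h5 : (-(Real.log Real.pi : ℂ) / 2).re = -(Real.log Real.pi) / 2 := by
    have : (-(Real.log Real.pi : ℂ) / 2) = ((-(Real.log Real.pi) / 2 : ℝ) : ℂ) := by push_cast; ring
    rw [this, Complex.ofReal_re]
  have h6 : (1 / (2 * s)).re = (1 / s).re / 2 := by
    have : (1 / (2 * s)) = ((1 / 2 : ℝ) : ℂ) * (1 / s) := by push_cast; field_simp
    rw [this, Complex.re_ofReal_mul]; ring
  have h7 : (L ↗Λ s).re ≤ ∑' n : ℕ, ‖term ↗Λ (s.re : ℂ) n‖ :=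
    (Complex.re_le_norm _).trans (norm_LSeries_vonMangoldt_le_tsum hs)
  have e1 : 1 / (6 * ‖s‖ ^ 2) = (1 / (3 * ‖s‖ ^ 2)) / 2 := by
    field_simp; ring
  have e2 : 1 / (Real.pi * s.re * ‖s‖ ^ 2) = (2 / (Real.pi * s.re * ‖s‖ ^ 2)) / 2 := by
    field_simp
  simp only [Complex.add_re, Complex.sub_re]
  rw [h4, h5, hψ, hlog, hlog2, h6, e1, e2]
  linarith


/-! ## §3 The symbol on the line `Im z = b`: `‖Θ_θ(u+ib)‖ ≤ (2π)^θ e^{2θε(σ)} σ^{−θ} (1 + θu²/(2σ²))⁻¹`, `σ = ½ + b ≥ 3` -/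

/-- Bernoulli for the line modulus: `‖s‖^{−θ} ≤ σ^{−θ} (1 + θ u²/(2σ²))⁻¹` when `‖s‖² = σ² + u²`, `σ > 0`, `θ ≥ 2`
(`(1 + u²/σ²)^{θ/2} ≥ 1 + (θ/2) u²/σ²`). -/
theorem rpow_neg_le_of_sq_eq {θ σ u N : ℝ} (hθ : 2 ≤ θ) (hσ : 0 < σ) (hN : 0 ≤ N) (hNsq : N ^ 2 = σ ^ 2 + u ^ 2) :
    N ^ (-θ) ≤ σ ^ (-θ) * (1 + θ / (2 * σ ^ 2) * u ^ 2)⁻¹ := by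
  have hq : 0 ≤ u ^ 2 / σ ^ 2 := by positivity
  have hbern : 1 + θ / 2 * (u ^ 2 / σ ^ 2) ≤ (1 + u ^ 2 / σ ^ 2) ^ (θ / 2) :=
    one_add_mul_self_le_rpow_one_add (by linarith) (by linarith)
  have hNpow : N ^ θ = σ ^ θ * (1 + u ^ 2 / σ ^ 2) ^ (θ / 2) := by
    have h1 : N ^ θ = (N ^ 2) ^ (θ / 2) := by
      rw [← Real.rpow_natCast N 2, ← Real.rpow_mul hN]; congr 1; push_cast; ring
    have h2 : σ ^ θ = (σ ^ 2) ^ (θ / 2) := by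
      rw [← Real.rpow_natCast σ 2, ← Real.rpow_mul hσ.le]; congr 1; push_cast; ring
    rw [h1, h2, hNsq, ← Real.mul_rpow (by positivity) (by positivity)]
    congr 1
    field_simp
  have hden : 0 < 1 + θ / (2 * σ ^ 2) * u ^ 2 := by positivity
  have hσθ : 0 < σ ^ θ := Real.rpow_pos_of_pos hσ θ
  have hlow : σ ^ θ * (1 + θ / (2 * σ ^ 2) * u ^ 2) ≤ N ^ θ := by
    rw [hNpow]
    refine mul_le_mul_of_nonneg_left ?_ hσθ.le
    calc 1 + θ / (2 * σ ^ 2) * u ^ 2 = 1 + θ / 2 * (u ^ 2 / σ ^ 2) := by ring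
      _ ≤ (1 + u ^ 2 / σ ^ 2) ^ (θ / 2) := hbern
  have hNθ : 0 < N ^ θ := lt_of_lt_of_le (by positivity) hlow
  rw [Real.rpow_neg hN, Real.rpow_neg hσ.le, ← mul_inv]
  exact inv_anti₀ (by positivity) hlow

/-- **Explicit symbol bound on the line** (RH-free): for `θ ≥ 2`, `σ = ½ + b ≥ 3` and all real `u`,
`‖Θ_θ(u + ib)‖ ≤ (2π)^θ · e^{2θ ε(σ)} · σ^{−θ} · (1 + θu²/(2σ²))⁻¹`,
`ε(σ) = 1/(6σ²) + 1/(πσ³) + (π²/6)·2^{3−σ}` (§2 with the non-negative terms `Re 1/(2s)`, `Re 1/(s−1)` dropped,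
`‖s‖ ≥ σ`, §1, and Bernoulli §3). -/
theorem norm_limTheta_le_explicit {θ : ℝ} (hθ : 2 ≤ θ) {b : ℝ} (hb : 5 / 2 ≤ b) (u : ℝ) :
    ‖limTheta θ ((u : ℂ) + (b : ℂ) * I)‖ ≤
      (2 * Real.pi) ^ θ * Real.exp (2 * θ * (1 / (6 * (1 / 2 + b) ^ 2) + 1 / (Real.pi * (1 / 2 + b) ^ 3)
          + Real.pi ^ 2 / 6 * (2 : ℝ) ^ (3 - (1 / 2 + b))))
        * (1 / 2 + b) ^ (-θ) * (1 + θ / (2 * (1 / 2 + b) ^ 2) * u ^ 2)⁻¹ := by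
  set σ : ℝ := 1 / 2 + b with hσdef
  set ε : ℝ := 1 / (6 * σ ^ 2) + 1 / (Real.pi * σ ^ 3) + Real.pi ^ 2 / 6 * (2 : ℝ) ^ (3 - σ) with hεdef
  have hσ3 : 3 ≤ σ := by rw [hσdef]; linarith
  have hσ0 : 0 < σ := by linarith
  rw [norm_limTheta]
  set s : ℂ := (1 : ℂ) / 2 - I * ((u : ℂ) + (b : ℂ) * I) with hsdef
  have hs : s = ((σ : ℝ) : ℂ) + ((-u : ℝ) : ℂ) * I := by
    rw [hsdef, hσdef]; push_cast; linear_combination (-(b : ℂ)) * I_mul_I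
  have hsre : s.re = σ := by rw [hs]; simp
  have hsim : s.im = -u := by rw [hs]; simp
  have hnormsq : ‖s‖ ^ 2 = σ ^ 2 + u ^ 2 := by
    rw [Complex.sq_norm, Complex.normSq_apply, hsre, hsim]; ring
  have hσle : σ ≤ ‖s‖ := by rw [← hsre]; exact Complex.re_le_norm s
  have hnorm0 : 0 < ‖s‖ := lt_of_lt_of_le hσ0 hσle
  -- §2 lower bound, with the non-negative terms dropped and `‖s‖ ≥ σ`
  have hlow := re_logDeriv_riemannXi_ge_explicit (s := s) (by rw [hsre]; linarith)
  rw [hsre] at hlow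
  have hP1 : 0 ≤ (1 / (2 * s)).re := by
    rw [one_div, Complex.inv_re]
    refine div_nonneg ?_ (Complex.normSq_nonneg _)
    simp [hsre]; linarith
  have hP2 : 0 ≤ (1 / (s - 1)).re := by
    rw [one_div, Complex.inv_re]
    refine div_nonneg ?_ (Complex.normSq_nonneg _)
    simp [hsre]; linarith
  have hZ := tsum_norm_term_vonMangoldt_le hσ3
  have hsq : σ ^ 2 ≤ ‖s‖ ^ 2 := pow_le_pow_left₀ hσ0.le hσle 2
  have hA : 1 / (6 * ‖s‖ ^ 2) ≤ 1 / (6 * σ ^ 2) := by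
    gcongr
  have hB : 1 / (Real.pi * σ * ‖s‖ ^ 2) ≤ 1 / (Real.pi * σ ^ 3) := by
    rw [show Real.pi * σ ^ 3 = Real.pi * σ * σ ^ 2 by ring]
    gcongr
  have hLD : Real.log (‖s‖ / (2 * Real.pi)) / 2 - ε ≤ (logDeriv riemannXi s).re := by
    rw [hεdef]; linarith
  -- exponentiate
  have hθ0 : 0 ≤ θ := by linarith
  have step : -2 * θ * (logDeriv riemannXi s).re ≤
      Real.log (‖s‖ / (2 * Real.pi)) * (-θ) + 2 * θ * ε := by
    have := mul_le_mul_of_nonneg_left hLD (by linarith : 0 ≤ 2 * θ)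
    nlinarith
  have hq0 : 0 < ‖s‖ / (2 * Real.pi) := by positivity
  have hmain : Real.exp (-2 * θ * (logDeriv riemannXi s).re) ≤
      (2 * Real.pi) ^ θ * Real.exp (2 * θ * ε) * ‖s‖ ^ (-θ) := by
    calc Real.exp (-2 * θ * (logDeriv riemannXi s).re)
        ≤ Real.exp (Real.log (‖s‖ / (2 * Real.pi)) * (-θ) + 2 * θ * ε) := Real.exp_le_exp.2 step
      _ = (‖s‖ / (2 * Real.pi)) ^ (-θ) * Real.exp (2 * θ * ε) := by
          rw [Real.exp_add, Real.rpow_def_of_pos hq0]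
      _ = (2 * Real.pi) ^ θ * Real.exp (2 * θ * ε) * ‖s‖ ^ (-θ) := by
          rw [Real.div_rpow hnorm0.le (by positivity), Real.rpow_neg (by positivity : (0:ℝ) ≤ 2 * Real.pi),
            div_inv_eq_mul]
          ring
  have hbern := rpow_neg_le_of_sq_eq hθ hσ0 hnorm0.le hnormsq
  calc Real.exp (-2 * θ * (logDeriv riemannXi s).re)
      ≤ (2 * Real.pi) ^ θ * Real.exp (2 * θ * ε) * ‖s‖ ^ (-θ) := hmain
    _ ≤ (2 * Real.pi) ^ θ * Real.exp (2 * θ * ε) * (σ ^ (-θ) * (1 + θ / (2 * σ ^ 2) * u ^ 2)⁻¹) :=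
        mul_le_mul_of_nonneg_left hbern (by positivity)
    _ = (2 * Real.pi) ^ θ * Real.exp (2 * θ * ε) * σ ^ (-θ) * (1 + θ / (2 * σ ^ 2) * u ^ 2)⁻¹ := by ring


/-! ## §3b The `u`-integral of the majorant -/

/-- `∫_ℝ du/(1 + c u²) = π/√c` for `c > 0` (Mathlib's `∫ (1+x²)⁻¹ = π`, rescaled). -/
theorem integral_inv_one_add_mul_sq {c : ℝ} (hc : 0 < c) :
    ∫ u : ℝ, (1 + c * u ^ 2)⁻¹ = Real.pi / Real.sqrt c := by
  have hsc : 0 < Real.sqrt c := Real.sqrt_pos.2 hc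
  have h := Measure.integral_comp_mul_left (fun x : ℝ => (1 + x ^ 2)⁻¹) (Real.sqrt c)
  have hfun : (fun x : ℝ => (1 + (Real.sqrt c * x) ^ 2)⁻¹) = fun u : ℝ => (1 + c * u ^ 2)⁻¹ := by
    funext u
    rw [mul_pow, Real.sq_sqrt hc.le]
  rw [hfun, integral_univ_inv_one_add_sq, abs_of_pos (inv_pos.2 hsc), smul_eq_mul] at h
  rw [h, div_eq_inv_mul]

/-- Integrability of `u ↦ (1 + c u²)⁻¹` for `c > 0`. -/
theorem integrable_inv_one_add_mul_sq {c : ℝ} (hc : 0 < c) :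
    Integrable fun u : ℝ => (1 + c * u ^ 2)⁻¹ := by
  have hsc : 0 < Real.sqrt c := Real.sqrt_pos.2 hc
  have h := integrable_inv_one_add_sq.comp_mul_left' hsc.ne'
  have hfun : (fun x : ℝ => (1 + (Real.sqrt c * x) ^ 2)⁻¹) = fun u : ℝ => (1 + c * u ^ 2)⁻¹ := by
    funext u
    rw [mul_pow, Real.sq_sqrt hc.le]
  rw [hfun] at h
  exact h

/-- `π/√(θ/(2σ²)) = π σ √(2/θ)` (`θ, σ > 0`). -/
theorem pi_div_sqrt_eq {θ σ : ℝ} (hθ : 0 < θ) (hσ : 0 < σ) :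
    Real.pi / Real.sqrt (θ / (2 * σ ^ 2)) = Real.pi * σ * Real.sqrt (2 / θ) := by
  have h1 : Real.sqrt (θ / (2 * σ ^ 2)) * (σ * Real.sqrt (2 / θ)) = 1 := by
    have hσ' : σ = Real.sqrt (σ ^ 2) := (Real.sqrt_sq hσ.le).symm
    calc Real.sqrt (θ / (2 * σ ^ 2)) * (σ * Real.sqrt (2 / θ))
        = Real.sqrt (θ / (2 * σ ^ 2)) * Real.sqrt (σ ^ 2) * Real.sqrt (2 / θ) := by rw [← hσ']; ring
      _ = Real.sqrt (θ / (2 * σ ^ 2) * σ ^ 2 * (2 / θ)) := by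
          rw [← Real.sqrt_mul (by positivity), ← Real.sqrt_mul (by positivity)]
      _ = 1 := by
          rw [show θ / (2 * σ ^ 2) * σ ^ 2 * (2 / θ) = 1 by field_simp]; simp
  have hpos : 0 < Real.sqrt (θ / (2 * σ ^ 2)) := Real.sqrt_pos.2 (by positivity)
  rw [div_eq_iff hpos.ne']
  calc Real.pi = Real.pi * (Real.sqrt (θ / (2 * σ ^ 2)) * (σ * Real.sqrt (2 / θ))) := by rw [h1, mul_one]
    _ = Real.pi * σ * Real.sqrt (2 / θ) * Real.sqrt (θ / (2 * σ ^ 2)) := by ring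

/-- **The `u`-integral of `‖Θ_θ‖` on the line `Im z = b`** (RH-free): for `θ ≥ 2`, `σ = ½ + b ≥ 3`,
`∫ ‖Θ_θ(u + ib)‖ du ≤ (2π)^θ e^{2θε(σ)} σ^{−θ} · π σ √(2/θ)`. -/
theorem integral_norm_limTheta_le_explicit {θ : ℝ} (hθ : 2 ≤ θ) {b : ℝ} (hb : 5 / 2 ≤ b) :
    ∫ u : ℝ, ‖limTheta θ ((u : ℂ) + (b : ℂ) * I)‖ ≤
      (2 * Real.pi) ^ θ * Real.exp (2 * θ * (1 / (6 * (1 / 2 + b) ^ 2) + 1 / (Real.pi * (1 / 2 + b) ^ 3)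
          + Real.pi ^ 2 / 6 * (2 : ℝ) ^ (3 - (1 / 2 + b))))
        * (1 / 2 + b) ^ (-θ) * (Real.pi * (1 / 2 + b) * Real.sqrt (2 / θ)) := by
  set σ : ℝ := 1 / 2 + b with hσdef
  set C : ℝ := (2 * Real.pi) ^ θ * Real.exp (2 * θ * (1 / (6 * σ ^ 2) + 1 / (Real.pi * σ ^ 3)
          + Real.pi ^ 2 / 6 * (2 : ℝ) ^ (3 - σ))) * σ ^ (-θ) with hCdef
  have hσ0 : 0 < σ := by rw [hσdef]; linarith
  have hθ0 : 0 < θ := by linarith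
  have hc : 0 < θ / (2 * σ ^ 2) := by positivity
  have hmaj : ∀ u : ℝ, ‖limTheta θ ((u : ℂ) + (b : ℂ) * I)‖ ≤ C * (1 + θ / (2 * σ ^ 2) * u ^ 2)⁻¹ :=
    fun u => norm_limTheta_le_explicit hθ hb u
  have hint : Integrable fun u : ℝ => C * (1 + θ / (2 * σ ^ 2) * u ^ 2)⁻¹ :=
    (integrable_inv_one_add_mul_sq hc).const_mul C
  calc ∫ u : ℝ, ‖limTheta θ ((u : ℂ) + (b : ℂ) * I)‖
      ≤ ∫ u : ℝ, C * (1 + θ / (2 * σ ^ 2) * u ^ 2)⁻¹ :=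
        integral_mono_of_nonneg (Eventually.of_forall fun u => norm_nonneg _) hint
          (Eventually.of_forall hmaj)
    _ = C * (Real.pi / Real.sqrt (θ / (2 * σ ^ 2))) := by
        rw [integral_const_mul, integral_inv_one_add_mul_sq hc]
    _ = C * (Real.pi * σ * Real.sqrt (2 / θ)) := by rw [pi_div_sqrt_eq hθ0 hσ0]

/-! ## §4 `K_θ` from the line `Re s = σ`: `|K_θ(x)| ≤ (2π)^{θ−1} π √(2/θ) e^{2θε(σ)} σ^{1−θ} e^{(σ−½)x}` -/

/-- **Line bound for `K_θ`** (RH-free; any line `σ = ½ + b ≥ 3`, `θ ≥ 2`, all real `x`):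
`|K_θ(x)| ≤ (2π)^{θ−1} · π √(2/θ) · e^{2θ ε(σ)} · σ^{1−θ} · e^{bx}` — the tree's `|K_θ(x)| ≤ (1/2π) e^{bx} ∫ ‖Θ_θ(u+ib)‖ du`
(line independence `invFourierLine_limTheta_eq` + `norm_invFourierLine_le`) with §3b. -/
theorem abs_limKernel_le_line {θ : ℝ} (hθ : 2 ≤ θ) {b : ℝ} (hb : 5 / 2 ≤ b) (x : ℝ) :
    |limKernel θ x| ≤
      (2 * Real.pi) ^ (θ - 1) * (Real.pi * Real.sqrt (2 / θ))
        * Real.exp (2 * θ * (1 / (6 * (1 / 2 + b) ^ 2) + 1 / (Real.pi * (1 / 2 + b) ^ 3)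
          + Real.pi ^ 2 / 6 * (2 : ℝ) ^ (3 - (1 / 2 + b))))
        * (1 / 2 + b) ^ (1 - θ) * Real.exp (b * x) := by
  set σ : ℝ := 1 / 2 + b with hσdef
  set X : ℝ := Real.exp (2 * θ * (1 / (6 * σ ^ 2) + 1 / (Real.pi * σ ^ 3)
          + Real.pi ^ 2 / 6 * (2 : ℝ) ^ (3 - σ))) with hXdef
  have hσ0 : 0 < σ := by rw [hσdef]; linarith
  have hθ1 : 1 < θ := by linarith
  have hb' : 1 / 2 < b := by linarith
  have hI := integral_norm_limTheta_le_explicit hθ hb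
  have h2pi : (0 : ℝ) < 2 * Real.pi := by positivity
  calc |limKernel θ x| = |(invFourierLine (limTheta θ) 1 x).re| := rfl
    _ ≤ ‖invFourierLine (limTheta θ) 1 x‖ := Complex.abs_re_le_norm _
    _ = ‖invFourierLine (limTheta θ) b x‖ := by rw [invFourierLine_limTheta_eq hθ1 (by norm_num) hb']
    _ ≤ 1 / (2 * Real.pi) * Real.exp (b * x) * ∫ u : ℝ, ‖limTheta θ ((u : ℂ) + (b : ℂ) * I)‖ :=
        norm_invFourierLine_le _ _ _
    _ ≤ 1 / (2 * Real.pi) * Real.exp (b * x) *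
        ((2 * Real.pi) ^ θ * X * σ ^ (-θ) * (Real.pi * σ * Real.sqrt (2 / θ))) := by gcongr
    _ = (2 * Real.pi) ^ (θ - 1) * (Real.pi * Real.sqrt (2 / θ)) * X * σ ^ (1 - θ) * Real.exp (b * x) := by
        rw [Real.rpow_sub_one h2pi.ne', show (1 : ℝ) - θ = 1 + (-θ) by ring, Real.rpow_add hσ0,
          Real.rpow_one]
        field_simp

end Summit.RiemannHypothesis.RiemannHypothesis.Theorems.SuzukiWindowsDoorExplicitSymbol

end
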